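import Mathlib.Topology.Instances.ZMod
import Literature.AnabelianGeometry.AbsoluteAnabelian.GaloisCyclotomeTowerLevels
import Literature.AnabelianGeometry.AbsoluteAnabelian.AbsTopIII.FreeProcyclicZHat
import HarnessLib

/-!
# `lim_{← i} ℤ/(i+1)!ℤ ≅ Ẑ`: the factorial-chain model of `Ẑ` is free procyclic

[AbsTopIII] (S. Mochizuki, *Topics in Absolute Anabelian Geometry III*) Cor. 1.10 (i)(a) p. 42 asserts
`H²(G_k, μ_Ẑ(G_k)) ⥲ Ẑ`; computed levelwise along the cofinal factorial chain `n_i = (i+1)!`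
(`cycLevel`, `GaloisCyclotomeTowerLevels.lean`) the target is the inverse limit `lim_{← i} ℤ/(i+1)!ℤ` of the
reductions `ℤ/(i+2)! ↠ ℤ/(i+1)!`.  This file identifies that limit with the cell's coefficient group
`ZHatCoeff = ULift (∏_p ℤ_p)` (abc-iut-L4-t1's `Ẑ`):

* `zmodChain` — `lim_{← i} ℤ/(i+1)!ℤ` as an additive subgroup of `∏_i ℤ/(i+1)!`, with
  `castHom_apply_of_le` (all the reductions `ℤ/(j+1)! ↠ ℤ/(i+1)!`, `i ≤ j`, are respected);
* it is closed in the compact product (`isClosed_zmodChain`, `CompactSpace`), the diagonal `ℤ → lim` has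
  dense image (`dense_zmultiples_one`), and the kernels of `lim ↠ ℤ/(i+1)! ↠ ℤ/n` are open subgroups of
  every index `n ≥ 1` (`exists_isOpen_index`) — i.e. `lim_{← i} ℤ/(i+1)!` is FREE PROCYCLIC in the sense
  of the tree's `FundamentalExtension.IsFreeProcyclic` (`isFreeProcyclic_zmodChain`);
* hence **`zmodChain ≃+ ZHatCoeff`** (`nonempty_zmodChain_addEquiv_zhat`), by the tree's
  `IsFreeProcyclic.exists_continuousAddEquiv_zhat` (free procyclic ⇒ `≅ ∏_p ℤ_p`).

Classical profinite bookkeeping (Ribes–Zalesskii Thm. 2.7.1: `Ẑ = lim_n ℤ/n` along any cofinal system);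
nothing here bears on [IUTchIII] Cor. 3.12.

## References
* [RibesZalesskii2010] L. Ribes, P. Zalesskii, *Profinite Groups*, 2nd ed., Thm. 2.7.1.
* [MochizukiAbsTopIII2015] S. Mochizuki, *Topics in Absolute Anabelian Geometry III*, Cor. 1.10 (i) p. 42.
-/

noncomputable section

open Function Topology Set

universe u

namespace Literature.AnabelianGeometry.AbsoluteAnabelian

/-! ### `lim_{← i} ℤ/(i+1)!` along the factorial chain -/

/-- `cycLevel i ∣ cycLevel (i+1)` in the form used by `ZMod.castHom`.
[cite: MochizukiAbsTopIII2015, Cor 1.10 (i) p.41] -/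
theorem cycLevel_dvd_succ (i : ℕ) : ((cycLevel i : ℕ+) : ℕ) ∣ ((cycLevel (i + 1) : ℕ+) : ℕ) :=
  Dvd.intro (i + 2) (by rw [cycLevel_succ]; rfl)

/-- **`lim_{← i} ℤ/(i+1)!ℤ`**: compatible families along the reductions `ℤ/(i+2)! ↠ ℤ/(i+1)!` (an
additive subgroup of `∏_i ℤ/(i+1)!`; a model of `Ẑ = lim_n ℤ/n` along the cofinal factorial chain).
[cite: RibesZalesskii2010, Thm 2.7.1] -/
def zmodChain : AddSubgroup (∀ i : ℕ, ZMod ((cycLevel i : ℕ+) : ℕ)) where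
  carrier := {x | ∀ i, ZMod.castHom (cycLevel_dvd_succ i) (ZMod ((cycLevel i : ℕ+) : ℕ)) (x (i + 1)) = x i}
  zero_mem' i := by simp
  add_mem' {a b} ha hb i := by
    simp only [Pi.add_apply, map_add, ha i, hb i]
  neg_mem' {a} ha i := by
    simp only [Pi.neg_apply, map_neg, ha i]

/-- Membership in `zmodChain`. [cite: RibesZalesskii2010, Thm 2.7.1] -/
theorem mem_zmodChain_iff (x : ∀ i : ℕ, ZMod ((cycLevel i : ℕ+) : ℕ)) :
    x ∈ zmodChain ↔
      ∀ i, ZMod.castHom (cycLevel_dvd_succ i) (ZMod ((cycLevel i : ℕ+) : ℕ)) (x (i + 1)) = x i :=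
  Iff.rfl

/-- The image of an integer `m ∈ ℤ` in `lim_i ℤ/(i+1)!`: the constant family `(m mod (i+1)!)_i`.
[cite: RibesZalesskii2010, Thm 2.7.1] -/
theorem intCast_mem_zmodChain (m : ℤ) :
    (fun i => (m : ZMod ((cycLevel i : ℕ+) : ℕ))) ∈ zmodChain :=
  fun _ => map_intCast _ m

/-- The diagonal element `𝟙 = (1, 1, 1, …) ∈ lim_i ℤ/(i+1)!` (the image of `1 ∈ ℤ`).
[cite: RibesZalesskii2010, Thm 2.7.1] -/
def zmodChainOne : zmodChain := ⟨fun i => (1 : ZMod ((cycLevel i : ℕ+) : ℕ)), fun _ => map_one _⟩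

/-- Components of `m • 𝟙`: `(m • 𝟙)_i = m mod (i+1)!`. [cite: RibesZalesskii2010, Thm 2.7.1] -/
@[simp] theorem coe_zsmul_zmodChainOne_apply (m : ℤ) (i : ℕ) :
    (m • zmodChainOne : zmodChain).1 i = (m : ZMod ((cycLevel i : ℕ+) : ℕ)) := by
  change (m • (fun i => (1 : ZMod ((cycLevel i : ℕ+) : ℕ)))) i = _
  simp

/-- All the reductions are respected: `x_j ↦ x_i` under `ℤ/(j+1)! ↠ ℤ/(i+1)!` for `i ≤ j`.
[cite: RibesZalesskii2010, Thm 2.7.1] -/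
theorem castHom_apply_of_le (x : zmodChain) {i j : ℕ} (h : i ≤ j) :
    ZMod.castHom (cycLevel_dvd h) (ZMod ((cycLevel i : ℕ+) : ℕ)) (x.1 j) =
      x.1 i := by
  induction h with
  | refl => rw [ZMod.castHom_self, RingHom.id_apply]
  | @step j hij ih =>
    rw [← ih, ← x.2 j, ← RingHom.comp_apply, ZMod.castHom_comp]

/-- The reductions in terms of representatives: `x_i = (x_j).val mod (i+1)!` for `i ≤ j`.
[cite: RibesZalesskii2010, Thm 2.7.1] -/
theorem natCast_val_apply_of_le (x : zmodChain) {i j : ℕ} (h : i ≤ j) :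
    (((x.1 j).val : ℕ) : ZMod ((cycLevel i : ℕ+) : ℕ)) = x.1 i := by
  rw [← castHom_apply_of_le x h, ZMod.castHom_apply, ZMod.cast_eq_val]

/-! ### Topology: closed in the compact product, dense diagonal, open subgroups of every index -/

/-- `lim_i ℤ/(i+1)!` is closed in `∏_i ℤ/(i+1)!`. [cite: RibesZalesskii2010, Thm 2.7.1] -/
theorem isClosed_zmodChain : IsClosed (zmodChain : Set (∀ i : ℕ, ZMod ((cycLevel i : ℕ+) : ℕ))) := by
  have h : (zmodChain : Set (∀ i : ℕ, ZMod ((cycLevel i : ℕ+) : ℕ))) =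
      ⋂ i, {x | ZMod.castHom (cycLevel_dvd_succ i) (ZMod ((cycLevel i : ℕ+) : ℕ)) (x (i + 1)) = x i} := by
    ext x
    simp only [SetLike.mem_coe, mem_zmodChain_iff, mem_iInter, mem_setOf_eq]
  rw [h]
  exact isClosed_iInter fun i => isClosed_eq
    ((continuous_of_discreteTopology (f := ZMod.castHom (cycLevel_dvd_succ i)
      (ZMod ((cycLevel i : ℕ+) : ℕ)))).comp (continuous_apply (i + 1))) (continuous_apply i)

/-- `lim_i ℤ/(i+1)!` is compact. [cite: RibesZalesskii2010, Thm 2.7.1] -/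
theorem compactSpace_zmodChain : CompactSpace zmodChain :=
  isCompact_iff_compactSpace.mp isClosed_zmodChain.isCompact

/-- **The diagonal `ℤ → lim_i ℤ/(i+1)!` has dense image**: every cylinder
`{y | y_i = x_i, i ≤ N}` around `x` contains `x_N.val • 𝟙`. [cite: RibesZalesskii2010, Thm 2.7.1] -/
theorem dense_zmultiples_one :
    Dense ((AddSubgroup.zmultiples zmodChainOne : AddSubgroup zmodChain) : Set zmodChain) := by
  rw [dense_iff_inter_open]
  intro U hU ⟨x, hx⟩
  obtain ⟨V, hV, rfl⟩ := isOpen_induced_iff.1 hU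
  obtain ⟨I, u, hu, hIV⟩ := isOpen_pi_iff.1 hV _ hx
  -- the top index of the cylinder and the integer representing `x` there
  let N : ℕ := I.sup id
  let m : ℤ := ((x.1 N).val : ℤ)
  refine ⟨m • zmodChainOne, hIV (fun a ha => ?_), m, rfl⟩
  have haN : a ≤ N := Finset.le_sup (f := id) ha
  rw [coe_zsmul_zmodChainOne_apply, Int.cast_natCast, natCast_val_apply_of_le x haN]
  exact (hu a ha).2

/-- The reduction `lim_i ℤ/(i+1)! ↠ ℤ/(i+1)! ↠ ℤ/n` (`n ∣ (i+1)!`), an additive homomorphism.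
[cite: RibesZalesskii2010, Thm 2.7.1] -/
def zmodChainRed (i : ℕ) (n : ℕ) (hn : n ∣ ((cycLevel i : ℕ+) : ℕ)) : zmodChain →+ ZMod n :=
  ((ZMod.castHom hn (ZMod n)).toAddMonoidHom.comp
    (Pi.evalAddMonoidHom (fun i : ℕ => ZMod ((cycLevel i : ℕ+) : ℕ)) i)).comp zmodChain.subtype

/-- Unfolding `zmodChainRed`. [cite: RibesZalesskii2010, Thm 2.7.1] -/
theorem zmodChainRed_apply (i n : ℕ) (hn : n ∣ ((cycLevel i : ℕ+) : ℕ)) (x : zmodChain) :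
    zmodChainRed i n hn x = ZMod.castHom hn (ZMod n) (x.1 i) := rfl

/-- The reductions are surjective (`m • 𝟙 ↦ m`). [cite: RibesZalesskii2010, Thm 2.7.1] -/
theorem zmodChainRed_surjective (i n : ℕ) [NeZero n] (hn : n ∣ ((cycLevel i : ℕ+) : ℕ)) :
    Surjective (zmodChainRed i n hn) := fun y => by
  refine ⟨((y.val : ℤ)) • zmodChainOne, ?_⟩
  rw [zmodChainRed_apply, coe_zsmul_zmodChainOne_apply, map_intCast, Int.cast_natCast,
    ZMod.natCast_zmod_val]

/-- The reductions are continuous. [cite: RibesZalesskii2010, Thm 2.7.1] -/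
theorem continuous_zmodChainRed (i n : ℕ) (hn : n ∣ ((cycLevel i : ℕ+) : ℕ)) :
    Continuous (zmodChainRed i n hn) :=
  ((continuous_of_discreteTopology (f := ZMod.castHom hn (ZMod n))).comp (continuous_apply i)).comp
    continuous_subtype_val

/-- **Open subgroups of every index**: for `n ≥ 1` the kernel of `lim_i ℤ/(i+1)! ↠ ℤ/n` (through
level `n! = cycLevel (n-1)`) is an open subgroup of index `n` of `Multiplicative (lim_i ℤ/(i+1)!)`.
[cite: RibesZalesskii2010, Thm 2.7.1] -/
theorem exists_isOpen_index {n : ℕ} (hn : 0 < n) :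
    ∃ H : Subgroup (Multiplicative zmodChain),
      IsOpen (H : Set (Multiplicative zmodChain)) ∧ H.index = n := by
  haveI : NeZero n := ⟨hn.ne'⟩
  let i : ℕ := PNat.natPred ⟨n, hn⟩
  have hdvd : n ∣ ((cycLevel i : ℕ+) : ℕ) := dvd_cycLevel_natPred ⟨n, hn⟩
  let f : Multiplicative zmodChain →* Multiplicative (ZMod n) := (zmodChainRed i n hdvd).toMultiplicative
  have hf : Surjective f := fun y => by
    obtain ⟨x, hx⟩ := zmodChainRed_surjective i n hdvd (Multiplicative.toAdd y)
    exact ⟨Multiplicative.ofAdd x, by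
      change Multiplicative.ofAdd (zmodChainRed i n hdvd x) = y
      rw [hx, ofAdd_toAdd]⟩
  refine ⟨f.ker, ?_, ?_⟩
  · have hc : Continuous f :=
      continuous_ofAdd.comp ((continuous_zmodChainRed i n hdvd).comp continuous_toAdd)
    have : (f.ker : Set (Multiplicative zmodChain)) = f ⁻¹' {1} := by
      ext x; simp [MonoidHom.mem_ker]
    rw [this]
    exact (isOpen_discrete _).preimage hc
  · rw [Subgroup.index_ker, MonoidHom.range_eq_top.mpr hf, Subgroup.card_top,
      Nat.card_congr (Multiplicative.toAdd : Multiplicative (ZMod n) ≃ ZMod n)]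
    exact Nat.card_zmod n

/-- `Dense` transfers from `zmultiples 𝟙` to `zpowers (ofAdd 𝟙)` (same set, same topology).
[cite: RibesZalesskii2010, Thm 2.7.1] -/
theorem dense_zpowers_ofAdd_one :
    Dense ((Subgroup.zpowers (Multiplicative.ofAdd zmodChainOne) :
      Subgroup (Multiplicative zmodChain)) : Set (Multiplicative zmodChain)) := by
  have h : ((Subgroup.zpowers (Multiplicative.ofAdd zmodChainOne) :
      Subgroup (Multiplicative zmodChain)) : Set (Multiplicative zmodChain)) =
      Multiplicative.toAdd ⁻¹' ((AddSubgroup.zmultiples zmodChainOne : AddSubgroup zmodChain) :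
        Set zmodChain) := by
    ext y
    simp only [SetLike.mem_coe, mem_preimage, Subgroup.mem_zpowers_iff, AddSubgroup.mem_zmultiples_iff]
    constructor
    · rintro ⟨m, rfl⟩
      exact ⟨m, by rw [← ofAdd_zsmul, toAdd_ofAdd]⟩
    · rintro ⟨m, hm⟩
      exact ⟨m, by rw [← ofAdd_zsmul, hm, ofAdd_toAdd]⟩
  rw [h]
  exact dense_zmultiples_one.preimage (Homeomorph.refl _).isOpenMap

/-- **`lim_{← i} ℤ/(i+1)!ℤ` is free procyclic** (dense cyclic subgroup `⟨𝟙⟩`, an open subgroup of every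
positive index). [cite: RibesZalesskii2010, Thm 2.7.1] -/
theorem isFreeProcyclic_zmodChain :
    FundamentalExtension.IsFreeProcyclic (Multiplicative zmodChain) where
  exists_dense_zpowers := ⟨_, dense_zpowers_ofAdd_one⟩
  exists_isOpen_index _ hn := exists_isOpen_index hn

/-! ### `lim_{← i} ℤ/(i+1)!ℤ ≅ Ẑ` -/

/-- **`lim_{← i} ℤ/(i+1)!ℤ ≃+ ZHatCoeff = ULift (∏_p ℤ_p)`** (the cell's `Ẑ`): a free procyclic compact
Hausdorff totally disconnected group is `≅ ∏_p ℤ_p` (tree `IsFreeProcyclic.exists_continuousAddEquiv_zhat`),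
read in any universe through `ULift`. [cite: RibesZalesskii2010, Thm 2.7.1] -/
theorem nonempty_zmodChain_addEquiv_zhat : Nonempty (zmodChain ≃+ AbsTopIII.ZHatCoeff.{u}) := by
  haveI : CompactSpace zmodChain := compactSpace_zmodChain
  haveI : CompactSpace (Multiplicative zmodChain) := inferInstanceAs (CompactSpace zmodChain)
  haveI : T2Space (Multiplicative zmodChain) := inferInstanceAs (T2Space zmodChain)
  haveI : TotallyDisconnectedSpace (Multiplicative zmodChain) :=
    inferInstanceAs (TotallyDisconnectedSpace zmodChain)
  obtain ⟨e, -⟩ := isFreeProcyclic_zmodChain.exists_continuousAddEquiv_zhat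
  exact ⟨((AddEquiv.additiveMultiplicative zmodChain).symm.trans e.toAddEquiv).trans
    (AddEquiv.ulift.trans AddEquiv.ulift.symm)⟩

end Literature.AnabelianGeometry.AbsoluteAnabelian

end
-- enqueue re-land 2026-08-26T07:33:57Z (stranded accept p427272: no olean ≈100 min after acceptance; no content change, every declaration byte-identical; filed by abc-iut-w5-d170 on behalf of abc-iut-L4-t17 so that the F-1387 closer p427386 can be verified)
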